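import Summits.ResolutionOfSingularities.ResolutionOfSingularities.Theorems.PurelyInseparableDim4AtlasReadingStepL
import Summits.ResolutionOfSingularities.ResolutionOfSingularities.Theorems.PurelyInseparableDim4AtlasShearMember
import Summits.ResolutionOfSingularities.ResolutionOfSingularities.Theorems.PurelyInseparableDim4AtlasNodeStep
import HarnessLib

/-!
# Purely inseparable four-folds: the HOST STEP for atlas members WITH LETTERS AND SHEARS — blow up one member, every entry of every reading
# becomes a tranche-2 atlas member of the new stage (brick S3 (c) v4, tranche 2, brick A3⁺; cell `res-dim4-pi`)

[OURS · counted 0] (D-0157 DOOR 2; host item stmt-ResolutionOfSingularities-16155, helper). Nothing here proves resolution of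
singularities in dimension ≥ 4 / characteristic `p`. Tranche-2 twin of `memberDataAT_host_step` (p720143; memo
`res-dim4-typ-3/S3c-V4-ATLAS-MEMBERS-DESIGN.md` §16, E-V4-4): for `c` carrying `MemberDataAL` (DefsFour) with readings `R`, blow up `𝓘(c)`;
at every reading `r ∈ R` the reading step with letters (`atlas_reading_step_L`) turns every entry `e ∈ plan r` into a child `kid r e` with
`MemberAtlasZL` for the UNSHEARED child readings with letters; the SHEAR OF RECORD of each child reading is then applied (G2
`memberAtlasZL_shear`, admissible by `BlockAL`'s `ShearOK` clauses, letters format by `childLetters_format`), the sheared states are non-zero,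
clean and permissible (`shearState_basics`), blocks and accessibility are inherited along `AEdgeL`; so every child carries `MemberDataAL` with
the readings `insert (mainReadingL r e) (image (extraReadingL r e) (T ∖ S″))`. Disjointness, the cover of the closed order-`p` points over `c`
modulo finitely many leaf points, and finiteness are tranche 1's, verbatim.

* `childLetters_format`, `aedgeL_mainReadingL`, `aedgeL_extraReadingL`, `childReadings_T_inj`, **`memberDataAL_host_step`** (A3⁺).

AI-produced formalisation, weaker than expert review. bears_on: LADDER-RESOLUTION:D157-DOOR2 (res-dim4-pi · S3 (c) v4 tranche 2 A3⁺).
-/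

set_option linter.dupNamespace false -- D-0017: single-problem summit path `Summit.<S>.<S>.…` by design

noncomputable section

open MvPolynomial Finset CategoryTheory AlgebraicGeometry Opposite TopologicalSpace
open AlgebraicGeometry.Scheme.IdealSheafData (ofIdealTop vanishingIdeal)

namespace Summit.ResolutionOfSingularities.ResolutionOfSingularities.Theorems.PIDim4

open Literature.AlgebraicGeometry.Resolution
open Literature.AlgebraicGeometry.Resolution.Hauser2010
open Literature.AlgebraicGeometry.Resolution.AffinePointBlowup (P A γ coord Wtop ξ)

namespace Equimultiple

section HostStepAL

variable {K : Type} [Field K] {p : ℕ} [hp : Fact p.Prime] [CharP K p] [DecidableEq K]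

omit hp [CharP K p] in
/-- The letters of a child reading satisfy the format «index in the centre ⇒ constant `0`». [folklore] -/
theorem childLetters_format (m : Fin 4) (b : Fin 4 → K) (T' : Finset (Fin 4)) (L : Finset (Fin 4 × K)) :
    ∀ ic ∈ childLetters m b T' L, ic.1 ∈ T' → ic.2 = 0 := by
  intro ic hic hi
  rcases Finset.mem_insert.mp hic with rfl | hic
  · rfl
  · rcases (Finset.mem_filter.mp hic).2 with h | h
    · exact absurd hi h
    · exact h

omit hp [CharP K p] in
/-- The main child reading with letters is an `AEdgeL`-successor. [folklore] -/
theorem aedgeL_mainReadingL (shr : AReading K → Fin 4 × (Fin 4 → K))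
    (plan : AReadingL K → Finset (Fin 4 × (Fin 4 → K) × Finset (Fin 4))) (r : AReadingL K)
    {e : Fin 4 × (Fin 4 → K) × Finset (Fin 4)} (he : e ∈ plan r) : AEdgeL p shr plan (mainReadingL p shr r e) r :=
  ⟨e, he, Or.inl rfl⟩

omit hp [CharP K p] in
/-- An extra child reading with letters is an `AEdgeL`-successor. [folklore] -/
theorem aedgeL_extraReadingL (shr : AReading K → Fin 4 × (Fin 4 → K))
    (plan : AReadingL K → Finset (Fin 4 × (Fin 4 → K) × Finset (Fin 4))) (r : AReadingL K)
    {e : Fin 4 × (Fin 4 → K) × Finset (Fin 4)} (he : e ∈ plan r) {l : Fin 4} (hl : l ∈ r.1.2.1 \ e.2.2) :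
    AEdgeL p shr plan (extraReadingL p shr r e l) r :=
  ⟨e, he, Or.inr ⟨l, hl, rfl⟩⟩

omit hp [CharP K p] in
/-- The unsheared child readings (with letters) of one entry have pairwise distinct centres. [folklore] -/
theorem childReadings_T_inj [DecidableEq (AReadingL K)] (r : AReading K) (e : Fin 4 × (Fin 4 → K) × Finset (Fin 4))
    (Ls : Finset (Fin 4 × K)) :
    ∀ q ∈ insert (mainReading p r e, mainLetters e Ls) ((r.2.1 \ e.2.2).image fun l => (extraReading p r e l, extraLetters e l Ls)),
      ∀ q' ∈ insert (mainReading p r e, mainLetters e Ls) ((r.2.1 \ e.2.2).image fun l => (extraReading p r e l, extraLetters e l Ls)),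
        q.1.2.1 = q'.1.2.1 → q = q' := by
  intro q hq q' hq' hT
  have hTm : (mainReading p r e, mainLetters e Ls).1.2.1 = e.2.2 := rfl
  have hTe : ∀ l, (extraReading p r e l, extraLetters e l Ls).1.2.1 = insert l (e.2.2.erase e.1) := fun l => rfl
  have hnot : ∀ l ∈ r.2.1 \ e.2.2, insert l (e.2.2.erase e.1) ≠ e.2.2 := fun l hl h =>
    (Finset.mem_sdiff.mp hl).2 (h ▸ Finset.mem_insert_self _ _)
  rcases Finset.mem_insert.mp hq with rfl | hq
  · rcases Finset.mem_insert.mp hq' with rfl | hq'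
    · rfl
    · obtain ⟨l, hl, rfl⟩ := Finset.mem_image.mp hq'
      rw [hTm, hTe] at hT
      exact absurd hT.symm (hnot l hl)
  · obtain ⟨l, hl, rfl⟩ := Finset.mem_image.mp hq
    rcases Finset.mem_insert.mp hq' with rfl | hq'
    · rw [hTm, hTe] at hT
      exact absurd hT (hnot l hl)
    · obtain ⟨l', hl', rfl⟩ := Finset.mem_image.mp hq'
      rw [hTe, hTe] at hT
      have hll : l = l' := by
        have h1 : l ∈ insert l' (e.2.2.erase e.1) := hT ▸ Finset.mem_insert_self _ _
        rcases Finset.mem_insert.mp h1 with h | h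
        · exact h
        · exact absurd (Finset.mem_of_mem_erase h) (Finset.mem_sdiff.mp hl).2
      subst hll
      rfl

variable {X' : Scheme.{0}}

/-- **THE HOST STEP OF AN ATLAS MEMBER WITH LETTERS AND SHEARS (A3⁺).** See the module docstring.
[cite: BierstoneGrigorievMilmanWlodarczyk2011, Def. 3.1.3; §4 Step 2b] [cite: Hauser2010, §§F–G] -/
theorem memberDataAL_host_step [IsAlgClosed K] [IsLocallyNoetherian X'] [DecidableEq (AReadingL K)] (M' : MarkedIdeal X')
    (hmult : M'.mult = p) (shr : AReading K → Fin 4 × (Fin 4 → K))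
    (plan : AReadingL K → Finset (Fin 4 × (Fin 4 → K) × Finset (Fin 4)))
    (leaves : AReadingL K → Finset (Fin 4 × (Fin 4 → K))) (c : Closeds X') {R : Finset (AReadingL K)}
    (h : MemberDataAL p shr plan leaves M' c R) :
    ∃ kid : AReadingL K → Fin 4 × (Fin 4 → K) × Finset (Fin 4) → Closeds (blowup (vanishingIdeal c)),
      (∀ r ∈ R, ∀ e ∈ plan r,
        MemberDataAL p shr plan leaves (M'.transform (blowup.π (vanishingIdeal c)) (vanishingIdeal c)) (kid r e)
            (insert (mainReadingL p shr r e) ((r.1.2.1 \ e.2.2).image fun l => extraReadingL p shr r e l)) ∧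
          (kid r e : Set (blowup (vanishingIdeal c))) ⊆ blowup.π (vanishingIdeal c) ⁻¹' (c : Set X') ∧
          (kid r e : Set (blowup (vanishingIdeal c))).Nonempty) ∧
      (∀ r ∈ R, ∀ e ∈ plan r, ∀ r' ∈ R, ∀ e' ∈ plan r', (r, e) ≠ (r', e') →
        Disjoint (kid r e : Set (blowup (vanishingIdeal c))) (kid r' e' : Set (blowup (vanishingIdeal c)))) ∧
      (∀ w : blowup (vanishingIdeal c), IsClosed ({w} : Set (blowup (vanishingIdeal c))) →
        blowup.π (vanishingIdeal c) w ∈ (c : Set X') →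
        (p : ℕ∞) ≤ idealOrder (M'.transform (blowup.π (vanishingIdeal c)) (vanishingIdeal c)).ideal w →
        (∃ r ∈ R, ∃ e ∈ plan r, w ∈ (kid r e : Set (blowup (vanishingIdeal c)))) ∨
        ∃ r ∈ R, ∃ l ∈ leaves r, l.1 ∈ r.1.2.1 ∧ l.2 l.1 = 0 ∧ CentreBlowup.IsEquimultiplePoint p r.1.2.1 l.1 l.2 r.1.1 ∧
          ∃ (Y' : Scheme.{0}) (φ' : Y' ⟶ blowup (vanishingIdeal c)) (ψ' : Y' ⟶ P 4 K) (_ : IsOpenImmersion φ')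
            (_ : IsOpenImmersion ψ') (y' : Y'), φ' y' = w ∧ ψ' y' = ξ 4 K ∧
            (M'.transform (blowup.π (vanishingIdeal c)) (vanishingIdeal c)).ideal.comap φ' =
              (hypSheaf p (CentreBlowup.step p r.1.2.1 l.1 l.2 r.1.1).F).comap ψ') ∧
      {w : blowup (vanishingIdeal c) | IsClosed ({w} : Set (blowup (vanishingIdeal c))) ∧
        blowup.π (vanishingIdeal c) w ∈ (c : Set X') ∧
        (p : ℕ∞) ≤ idealOrder (M'.transform (blowup.π (vanishingIdeal c)) (vanishingIdeal c)).ideal w ∧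
        ∀ r ∈ R, ∀ e ∈ plan r, w ∉ (kid r e : Set (blowup (vanishingIdeal c)))}.Finite := by
  classical
  obtain ⟨hbasic, hfmt, hreg, hsnc, hatlas, hblocks, hacc⟩ := h
  obtain ⟨Yc, φ, ψ, hcl, hcov, hdis⟩ := hatlas
  set Ce : X'.IdealSheafData := vanishingIdeal c with hCe
  have hπ : IsBlowup (blowup.π Ce) Ce := blowup.isBlowup Ce
  haveI : IsProper (blowup.π Ce) := hπ.isProper
  haveI : IsLocallyNoetherian (blowup Ce) := LocallyOfFiniteType.isLocallyNoetherian (blowup.π Ce)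
  -- the reading step at every reading
  have step : ∀ r : ↥R, ∃ kid : Fin 4 × (Fin 4 → K) × Finset (Fin 4) → Closeds (blowup Ce),
      (∀ e ∈ plan r.1,
        Scheme.IsRegular (vanishingIdeal (kid e)).subscheme ∧
        HasSNCWith (M'.transform (blowup.π Ce) Ce).boundary (vanishingIdeal (kid e)) ∧
        MemberAtlasZL p (M'.transform (blowup.π Ce) Ce) (kid e)
          (insert (mainReading p r.1.1 e, mainLetters e r.1.2)
            ((r.1.1.2.1 \ e.2.2).image fun l => (extraReading p r.1.1 e l, extraLetters e l r.1.2))) ∧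
        (kid e : Set (blowup Ce)) ⊆ blowup.π Ce ⁻¹' (φ r '' (ψ r ⁻¹' ownedSetZ r.1.1.2.1 ((e.2.2 \ r.1.1.2.1).image fun m => (m, e.2.1 m)))) ∧
        (kid e : Set (blowup Ce)).Nonempty) ∧
      (∀ e ∈ plan r.1, ∀ e' ∈ plan r.1, e ≠ e' → Disjoint (kid e : Set (blowup Ce)) (kid e' : Set (blowup Ce))) ∧
      (∀ w : blowup Ce, IsClosed ({w} : Set (blowup Ce)) → blowup.π Ce w ∈ φ r '' (ψ r ⁻¹' ownedSetZ r.1.1.2.1 r.1.1.2.2.1) →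
        (p : ℕ∞) ≤ idealOrder (M'.transform (blowup.π Ce) Ce).ideal w →
        (∃ e ∈ plan r.1, w ∈ (kid e : Set (blowup Ce))) ∨
        ∃ l ∈ leaves r.1, l.1 ∈ r.1.1.2.1 ∧ l.2 l.1 = 0 ∧ CentreBlowup.IsEquimultiplePoint p r.1.1.2.1 l.1 l.2 r.1.1.1 ∧
          ∃ (Y' : Scheme.{0}) (φ' : Y' ⟶ blowup Ce) (ψ' : Y' ⟶ P 4 K) (_ : IsOpenImmersion φ') (_ : IsOpenImmersion ψ') (y' : Y'),
            φ' y' = w ∧ ψ' y' = ξ 4 K ∧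
            (M'.transform (blowup.π Ce) Ce).ideal.comap φ' = (hypSheaf p (CentreBlowup.step p r.1.1.2.1 l.1 l.2 r.1.1.1).F).comap ψ') ∧
      {w : blowup Ce | IsClosed ({w} : Set (blowup Ce)) ∧ blowup.π Ce w ∈ φ r '' (ψ r ⁻¹' ownedSetZ r.1.1.2.1 r.1.1.2.2.1) ∧
        (p : ℕ∞) ≤ idealOrder (M'.transform (blowup.π Ce) Ce).ideal w ∧ ∀ e ∈ plan r.1, w ∉ (kid e : Set (blowup Ce))}.Finite := by
    intro r
    obtain ⟨hφ, hψ, hM, hZ, hsee, hfib, idx, cst_, hshape, hinj⟩ := hcl r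
    set B := blowup.π (AffineCoordBlowup.𝓘Λ 4 K (insert 0 (Fin.succ '' (r.1.1.2.1 : Set (Fin 4))))) with hBdef
    have hB : IsBlowup B (AffineCoordBlowup.𝓘Λ 4 K (insert 0 (Fin.succ '' (r.1.1.2.1 : Set (Fin 4))))) := blowup.isBlowup _
    obtain ⟨ε, hsq, hC', hKEY⟩ := ChartDictionary.exists_iso_restrict_blowup_zigzag (φ r) (ψ r) _ Ce hZ hπ hB
    have hK := hKEY M'.ideal (hypSheaf p r.1.1.1.F) p hM
    obtain ⟨hF, hclean, hperm⟩ := hbasic r.1 r.2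
    obtain ⟨hX, hDS⟩ := hfmt r.1 r.2
    obtain ⟨⟨hP1, hP2, -, hP5⟩, -, -⟩ := hblocks r.1 r.2 r.1 Relation.ReflTransGen.refl
    obtain ⟨kid, Θ, hkid, hkdisj, hkcover, hkfin⟩ :=
      atlas_reading_step_L (φ r) (ψ r) ε Ce hπ hB hsq hC' M' hmult r.1.1.1 hF hclean hK hperm.2 hsee hsnc idx cst_
        (fun D hD hne => ⟨(hshape D hD hne).1, (hshape D hD hne).2.1⟩) hinj r.1.2 (fun D hD hne => (hshape D hD hne).2.2)
        r.1.1.2.2.1 r.1.1.2.2.2 hX hDS hfib (plan r.1) hP1 hP2 (leaves r.1) hP5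
    refine ⟨kid, fun e he => ?_, hkdisj, hkcover, hkfin⟩
    obtain ⟨-, -, -, -, -, hover, hne, hregk, hsnck, hatk⟩ := hkid e he
    exact ⟨hregk, hsnck, hatk, hover, hne⟩
  choose kid hkid hkdisj hkcover hkfin using step
  -- owned parts: a child lies over the owned part of its reading
  have hownsub : ∀ (r : ↥R) (e : Fin 4 × (Fin 4 → K) × Finset (Fin 4)), e ∈ plan r.1 →
      ownedSetZ r.1.1.2.1 ((e.2.2 \ r.1.1.2.1).image fun m => (m, e.2.1 m)) ⊆ ownedSetZ r.1.1.2.1 r.1.1.2.2.1 := by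
    intro r e he x hx
    obtain ⟨-, -, -, hD, hown, -⟩ := (hblocks r.1 r.2 r.1 Relation.ReflTransGen.refl).1.1 e he
    obtain ⟨hX, hDS⟩ := hfmt r.1 r.2
    rw [ownedSetZ_image_eq] at hx
    refine ⟨hx.1, fun iv hiv => ?_⟩
    have h1 := hx.2 iv.1 (Finset.mem_sdiff.mpr ⟨hD (hX iv hiv), hDS iv.1 (hX iv hiv)⟩)
    rwa [hown iv hiv] at h1
  have hkover : ∀ (r : ↥R) (e : Fin 4 × (Fin 4 → K) × Finset (Fin 4)), e ∈ plan r.1 →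
      (kid r e : Set (blowup Ce)) ⊆ blowup.π Ce ⁻¹' (φ r '' (ψ r ⁻¹' ownedSetZ r.1.1.2.1 r.1.1.2.2.1)) := fun r e he w hw =>
    Set.preimage_mono (Set.image_mono (Set.preimage_mono (hownsub r e he))) ((hkid r e he).2.2.2.1 hw)
  have hownc : ∀ r : ↥R, φ r '' (ψ r ⁻¹' ownedSetZ r.1.1.2.1 r.1.1.2.2.1) ⊆ (c : Set X') := fun r => by
    obtain ⟨-, -, -, hZ, -⟩ := hcl r
    exact image_preimage_subset_member (φ r) (ψ r) c hZ fun x hx => by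
      simp only [ownedSetZ, Set.mem_setOf_eq] at hx; exact hx.1
  -- the children, indexed by readings of `R`
  let kid' : AReadingL K → Fin 4 × (Fin 4 → K) × Finset (Fin 4) → Closeds (blowup Ce) := fun r e =>
    if hr : r ∈ R then kid ⟨r, hr⟩ e else ⊥
  have hkid' : ∀ r (hr : r ∈ R) e, kid' r e = kid ⟨r, hr⟩ e := fun r hr e => by simp only [kid', dif_pos hr]
  refine ⟨kid', fun r hr e he => ?_, fun r hr e he r' hr' e' he' hne => ?_, fun w hw hwc hord => ?_, ?_⟩
  · -- every child is a tranche-2 atlas member of the new stage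
    rw [hkid' r hr]
    obtain ⟨hregk, hsnck, hatk, hover, hne⟩ := hkid ⟨r, hr⟩ e he
    obtain ⟨hF, hclean, hperm⟩ := hbasic r hr
    obtain ⟨hX, hDS⟩ := hfmt r hr
    obtain ⟨hBA, -, hshr⟩ := hblocks r hr r Relation.ReflTransGen.refl
    obtain ⟨hj, hbj, hjS'', hD, hown, heq, hperm', hesc⟩ := hBA.1 e he
    obtain ⟨hOKm, hOKe⟩ := hshr e he
    -- basics of the UNSHEARED child states
    have hbas₀ : ∀ q ∈ insert (mainReading p r.1 e, mainLetters e r.2)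
        ((r.1.2.1 \ e.2.2).image fun l => (extraReading p r.1 e l, extraLetters e l r.2)),
        q.1.1.F ≠ 0 ∧ Literature.Barriers.ResolutionOfSingularities.HauserPerlega.IsClean p q.1.1.F ∧
          IsPermissibleCentre p q.1.2.1 q.1.1.F ∧ (∀ ic ∈ q.2, ic.1 ∈ q.1.2.1 → ic.2 = 0) ∧
          ((∀ iv ∈ q.1.2.2.1, iv.1 ∈ q.1.2.2.2) ∧ ∀ m ∈ q.1.2.2.2, m ∉ q.1.2.1) ∧ ShearOK q.1.2.1 q.2 (shr q.1) := by
      intro q hq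
      rcases Finset.mem_insert.mp hq with rfl | hq
      · exact ⟨step_F_ne_zero_of_isClean hj e.2.1 r.1.1 hF hclean hperm.2, isClean_step r.1.2.1 e.1 e.2.1 r.1.1, hperm',
          childLetters_format _ _ _ _, mainReading_format p r.1 e hX hD, hOKm⟩
      · obtain ⟨l, hl, rfl⟩ := Finset.mem_image.mp hq
        obtain ⟨hlS, hlS''⟩ := Finset.mem_sdiff.mp hl
        have hE : IsEscaping r.1.2.1 e := fun hsub => hlS'' (hsub hlS)
        obtain ⟨hbS, hpermE⟩ := hesc hE
        obtain ⟨Θⱼ, -, -, -, -, ⟨-, -, -, -, -⟩, -, hrest⟩ :=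
          globalCentre_atlas_package_linearEscaping
            (π := blowup.π (AffineCoordBlowup.𝓘Λ 4 K (insert 0 (Fin.succ '' (r.1.2.1 : Set (Fin 4))))))
            hj hjS'' hbS r.1.1 hF hclean hperm.2 (blowup.isBlowup _) hperm'.2
            [] [] 0 0 (fun _ _ => rfl) (fun i hi => absurd hi (List.not_mem_nil)) (fun i hi => absurd hi (List.not_mem_nil))
        obtain ⟨Θ', g', -, -, -, -, -, hneF, hcl', -, -⟩ := hrest l hlS hlS''
        exact ⟨hneF, hcl', hpermE l hl, childLetters_format _ _ _ _, extraReading_format p r.1 e hX hD hDS hj hjS'' hl, hOKe l hl⟩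
    -- the shear of record of every child reading (G2)
    have hatk' := memberAtlasZL_shear (p := p) (M'.transform (blowup.π Ce) Ce) (kid ⟨r, hr⟩ e) shr _ hatk
      (fun q hq => le_trans (by exact_mod_cast hp.out.one_lt.le) (hbas₀ q hq).2.2.1.2)
      (fun q hq => (hbas₀ q hq).2.2.2.1)
      (fun q hq iv hiv => (hbas₀ q hq).2.2.2.2.1.2 iv.1 ((hbas₀ q hq).2.2.2.2.1.1 iv hiv))
      (fun q hq => (hbas₀ q hq).2.2.2.2.1.2) (fun q hq => (hbas₀ q hq).2.2.2.2.2) (childReadings_T_inj r.1 e r.2)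
    have hR₁ : (insert (mainReading p r.1 e, mainLetters e r.2)
        ((r.1.2.1 \ e.2.2).image fun l => (extraReading p r.1 e l, extraLetters e l r.2))).image
        (fun q : AReadingL K => (shearReading p shr q.1, q.2)) =
        insert (mainReadingL p shr r e) ((r.1.2.1 \ e.2.2).image fun l => extraReadingL p shr r e l) := by
      rw [Finset.image_insert, Finset.image_image]
      rfl
    rw [hR₁] at hatk'
    -- the sheared readings are images of the unsheared ones
    have hmemR₁ : ∀ q ∈ insert (mainReadingL p shr r e) ((r.1.2.1 \ e.2.2).image fun l => extraReadingL p shr r e l),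
        ∃ q₀ ∈ insert (mainReading p r.1 e, mainLetters e r.2)
          ((r.1.2.1 \ e.2.2).image fun l => (extraReading p r.1 e l, extraLetters e l r.2)),
          q = (shearReading p shr q₀.1, q₀.2) ∧ AEdgeL p shr plan q r := by
      intro q hq
      rcases Finset.mem_insert.mp hq with rfl | hq
      · exact ⟨_, Finset.mem_insert_self _ _, rfl, aedgeL_mainReadingL shr plan r he⟩
      · obtain ⟨l, hl, rfl⟩ := Finset.mem_image.mp hq
        exact ⟨_, Finset.mem_insert_of_mem (Finset.mem_image.mpr ⟨l, hl, rfl⟩), rfl, aedgeL_extraReadingL shr plan r he hl⟩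
    refine ⟨⟨fun q hq => ?_, fun q hq => ?_, hregk, hsnck, hatk', fun q hq q' hq' => ?_, fun q hq => ?_⟩,
      fun w hw => hownc ⟨r, hr⟩ (hkover ⟨r, hr⟩ e he hw), hne⟩
    · -- basics of the sheared child states
      obtain ⟨q₀, hq₀, rfl, -⟩ := hmemR₁ q hq
      obtain ⟨hF₀, hclean₀, hperm₀, hfmtL₀, -, hOK₀⟩ := hbas₀ q₀ hq₀
      exact shearState_basics (p := p) hOK₀ hfmtL₀ q₀.1.1 hF₀ hclean₀ hperm₀
    · -- the format invariant (unchanged by the shear)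
      obtain ⟨q₀, hq₀, rfl, -⟩ := hmemR₁ q hq
      exact (hbas₀ q₀ hq₀).2.2.2.2.1
    · -- blocks along `AEdgeL`
      obtain ⟨q₀, -, -, hedge⟩ := hmemR₁ q hq
      exact hblocks r hr q' (Relation.ReflTransGen.head hedge hq')
    · -- accessibility
      obtain ⟨q₀, -, -, hedge⟩ := hmemR₁ q hq
      exact (hacc r hr).inv hedge
  · -- pairwise disjointness
    rw [hkid' r hr, hkid' r' hr']
    by_cases hrr : r = r'
    · subst hrr
      have hee : e ≠ e' := fun h => hne (by rw [h])
      exact hkdisj ⟨r, hr⟩ e he e' he' hee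
    · have hne' : (⟨r, hr⟩ : ↥R) ≠ ⟨r', hr'⟩ := fun h => hrr (Subtype.ext_iff.mp h)
      refine Set.disjoint_left.mpr fun w hw hw' => ?_
      exact Set.disjoint_left.mp (hdis _ _ hne') (hkover ⟨r, hr⟩ e he hw) (hkover ⟨r', hr'⟩ e' he' hw')
  · -- the cover over `c`
    obtain ⟨r, hr⟩ := Set.mem_iUnion.mp (hcov hwc)
    rcases hkcover r w hw hr hord with ⟨e, he, hwe⟩ | ⟨l, hl, hrest⟩
    · exact Or.inl ⟨r.1, r.2, e, he, by rw [hkid' r.1 r.2]; exact hwe⟩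
    · exact Or.inr ⟨r.1, r.2, l, hl, hrest⟩
  · -- finitely many leaf points
    refine (Set.finite_iUnion fun r : ↥R => hkfin r).subset fun w hw => ?_
    obtain ⟨hwcl, hwc, hord, hout⟩ := hw
    obtain ⟨r, hr⟩ := Set.mem_iUnion.mp (hcov hwc)
    exact Set.mem_iUnion.mpr ⟨r, hwcl, hr, hord, fun e he => by rw [← hkid' r.1 r.2]; exact hout r.1 r.2 e he⟩

end HostStepAL

end Equimultiple

end Summit.ResolutionOfSingularities.ResolutionOfSingularities.Theorems.PIDim4

end
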